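import Literature.Analysis.FunctionSpaces.TorusSpaceTimeL3Cauchy
import HarnessLib

/-!
# Stub `stub_krSpaceTimeCauchy` (H5) of the plan for `stub_kolmogorovRieszPeriodicSlab`
(line `tight`, crux `EulerLimit.EulerlimitThesisV2`, stmt-AnomalousDissipation-0511)

**An `L³((0,T) × T^d)` Cauchy criterion: uniform mollification error in space, convergence of the
Fourier modes in time.**  This is the modulus/mollification variant of the tree's
`Literature.Analysis.FunctionSpaces.Torus.exists_forall_lintegral_sub_pow_three_le_of_modes`
(`TorusSpaceTimeL3Cauchy`; Simon 1987, §8; De Rosa–Isett 2024, §6.1): there the smallness of the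
mollification error `w_n - ρ_ε ⋆ w_n` in `L³_{t,x}` came from a uniform `L³_t B^θ_{3,∞}` Besov bound
through `Torus.eLpNorm_kernel_convolution_sub_self_le_eBesovSupSeminorm`; here it is ASSUMED directly
(hypothesis `hmoll`: for every `ρ > 0` some scale `ε ∈ (0, 1/4]` has
`∫₀ᵀ∫ ‖ρ_ε ⋆ w_n(t) - w_n(t)‖³ ≤ ρ` for all `n`), which is what the Kolmogorov–Riesz space modulus
supplies (`stub_krMollifyError`).  Neither statement is a special case of the other as typed; the
Besov version follows from this one by the cited Besov estimate.  The rest of the argument —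
`w_n - w_m = (ρ_ε⋆w_m - w_m) - (ρ_ε⋆w_n - w_n) + ρ_ε⋆(w_n - w_m)`, finitely many modes of the
difference plus the Fourier tail of the mollifier (`Torus.norm_kernel_convolution_apply_le`,
`Torus.tendsto_tsum_compl_norm_mFourierCoeff_kernel`) — is unchanged.  Generic in `d`; the file
ends with the REGISTERED sub-stub `stub_krSpaceTimeCauchy` (`d = Fin 3`), signature verbatim.
-/

noncomputable section

-- D-0017: single-problem summit ⇒ the duplicated namespace segment is by design.
set_option linter.dupNamespace false

open MeasureTheory Set Function Filter UnitAddTorus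
open scoped ENNReal NNReal Topology Convolution

namespace Summit.AnomalousDissipation.AnomalousDissipation.Theorems.EulerLimitKR

open Literature.Analysis.FunctionSpaces Literature.Analysis.FunctionSpaces.Torus

/-- **`L³((0,T) × T^d)` Cauchy criterion: uniform mollification error in space, convergent
Fourier modes in time (H5)** (modulus variant of
`Torus.exists_forall_lintegral_sub_pow_three_le_of_modes`; Simon 1987, §8, Thm. 5; De Rosa–Isett
2024, §6.1).  Let `w_n` be jointly smooth on `(0,T) × T^d` with `∫₀ᵀ∫ ‖w_n‖³ ≤ B < ∞`, suppose the
mollification errors `∫₀ᵀ∫ ‖ρ_ε ⋆ w_n(t) - w_n(t)‖³` can be made `≤ ρ` uniformly in `n` by a choice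
of `ε ∈ (0, 1/4]`, for every `ρ > 0`, and that for every frequency `k` the coefficient functions
`t ↦ ŵ_n(t,k)` form a Cauchy sequence in `L³(0,T)`.  Then `(w_n)` is Cauchy in `L³((0,T) × T^d)`:
for every `η > 0` there is `N` with `∫₀ᵀ∫ ‖w_n - w_m‖³ ≤ η` for `n, m ≥ N`. [cite: Simon1986, §8 Thm. 5] -/
theorem exists_forall_lintegral_sub_pow_three_le_of_modes_of_mollify
    {d : Type*} [Fintype d] [DecidableEq d] {T : ℝ} (hT : 0 < T)
    {w : ℕ → ℝ → UnitAddTorus d → EuclideanSpace ℝ d}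
    (hw : ∀ n, IsSmoothSpaceTimeOn (Ioo 0 T) (w n))
    {B : ℝ≥0∞} (hB : B ≠ ⊤)
    (hwB : ∀ n, ∫⁻ t in Ioo 0 T, ∫⁻ x, ‖w n t x‖ₑ ^ 3 ≤ B)
    (hmoll : ∀ ρ : ℝ≥0∞, 0 < ρ → ∃ ε : ℝ, 0 < ε ∧ ε ≤ 1 / 4 ∧ ∀ n,
      ∫⁻ t in Ioo 0 T, ∫⁻ x, ‖(kernel ε ⋆ w n t) x - w n t x‖ₑ ^ 3 ≤ ρ)
    (hmode : ∀ k : d → ℤ, ∀ η : ℝ≥0∞, 0 < η → ∃ N : ℕ, ∀ n m : ℕ, N ≤ n → N ≤ m →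
      ∫⁻ t in Ioo 0 T, ‖mFourierCoeff (EuclideanSpace.complexify ∘ w n t) k -
        mFourierCoeff (EuclideanSpace.complexify ∘ w m t) k‖ₑ ^ 3 ≤ η)
    {η : ℝ≥0∞} (hη : 0 < η) :
    ∃ N : ℕ, ∀ n m : ℕ, N ≤ n → N ≤ m →
      ∫⁻ t in Ioo 0 T, ∫⁻ x, ‖w n t x - w m t x‖ₑ ^ 3 ≤ η := by
  -- the product measure and the cube-root target
  set μT : Measure (ℝ × UnitAddTorus d) := (volume.restrict (Ioo 0 T)).prod volume with hμT
  set ρ : ℝ≥0∞ := η ^ (1 / 3 : ℝ) with hρ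
  have hρpos : 0 < ρ := ENNReal.rpow_pos_of_nonneg hη (by norm_num)
  have hρ3 : 0 < ρ / 3 := ENNReal.div_pos hρpos.ne' (by norm_num)
  set ρ6 : ℝ≥0∞ := ρ / 3 / 2 with hρ6
  have hρ6pos : 0 < ρ6 := ENNReal.div_pos hρ3.ne' (by norm_num)
  set B3 : ℝ≥0∞ := B ^ (1 / 3 : ℝ) with hB3def
  have hB3 : B3 ≠ ⊤ := ENNReal.rpow_ne_top_of_nonneg (by norm_num) hB
  -- Step 1: choice of the mollification scale `ε`
  obtain ⟨ε, hε0, hε4, hmollε⟩ := hmoll (ρ6 ^ 3) (ENNReal.pow_pos hρ6pos 3)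
  have hkint : Integrable (kernel (d := d) ε) volume := (continuous_kernel hε0 hε4).integrable_unitAddTorus
  -- Step 2: choice of the truncation order `K`
  set τ : ℕ → ℝ := fun K => ∑' k : {k // k ∉ freqBall (d := d) K},
    ‖mFourierCoeff (fun y => (kernel ε y : ℂ)) (k : d → ℤ)‖ with hτ
  have hτ0 : ∀ K, 0 ≤ τ K := fun K => tsum_nonneg fun _ => norm_nonneg _
  obtain ⟨K, hK⟩ : ∃ K : ℕ, ENNReal.ofReal (τ K) * (2 * B3) ≤ ρ / 3 := by
    have h1 : Tendsto (fun K => ENNReal.ofReal (τ K)) atTop (𝓝 0) := by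
      simpa using ENNReal.tendsto_ofReal (tendsto_tsum_compl_norm_mFourierCoeff_kernel (d := d) ε)
    have h2 : Tendsto (fun K => ENNReal.ofReal (τ K) * (2 * B3)) atTop (𝓝 0) := by
      have h := ENNReal.Tendsto.mul_const (b := 2 * B3) h1
        (Or.inr (ENNReal.mul_ne_top (by norm_num) hB3))
      simpa using h
    exact (h2.eventually (ge_mem_nhds hρ3)).exists
  -- Step 3: choice of `N` from the finitely many modes `|k| ≤ K`
  set c : ℝ≥0∞ := ((freqBall (d := d) K).card : ℝ≥0∞) with hc
  set δ : ℝ≥0∞ := ρ / 3 / c with hδ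
  have hδpos : 0 < δ := ENNReal.div_pos hρ3.ne' (ENNReal.natCast_ne_top _)
  have hδ3 : 0 < δ ^ 3 := ENNReal.pow_pos hδpos 3
  choose Nk hNk using fun k : d → ℤ => hmode k (δ ^ 3) hδ3
  refine ⟨(freqBall (d := d) K).sup Nk, fun n m hn hm => ?_⟩
  have hNk' : ∀ k ∈ freqBall (d := d) K, Nk k ≤ n ∧ Nk k ≤ m := fun k hk =>
    ⟨(Finset.le_sup hk).trans hn, (Finset.le_sup hk).trans hm⟩
  -- Step 4: notation for the pair `(n, m)`
  set D : ℝ → UnitAddTorus d → EuclideanSpace ℝ d := fun t y => w n t y - w m t y with hD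
  set P : ℕ → ℝ → UnitAddTorus d → EuclideanSpace ℝ d :=
    fun j t x => (kernel ε ⋆ w j t) x - w j t x with hP
  set Q : ℝ → UnitAddTorus d → EuclideanSpace ℝ d :=
    fun t x => (kernel ε ⋆ w n t) x - (kernel ε ⋆ w m t) x with hQ
  set Dhat : ℝ → (d → ℤ) → EuclideanSpace ℂ d :=
    fun t k => mFourierCoeff (EuclideanSpace.complexify ∘ D t) k with hDhat
  set S : ℝ → ℝ := fun t => ∑ k ∈ freqBall (d := d) K, ‖Dhat t k‖ with hS
  set mm : ℝ → ℝ := fun t => ∫ y, ‖D t y‖ with hmm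
  -- smoothness and measurability
  have hDst : IsSmoothSpaceTimeOn (Ioo 0 T) D := (hw n).sub (hw m)
  have hKst : ∀ j, IsSmoothSpaceTimeOn (Ioo 0 T) (fun t => kernel ε ⋆ w j t) := fun j =>
    (hw j).convolution hkint (convex_Ioo 0 T) (by rw [interior_Ioo]; exact nonempty_Ioo.2 hT)
  have hmw : ∀ j, AEStronglyMeasurable (uncurry (w j)) μT := fun j =>
    (hw j).aestronglyMeasurable_uncurry_prod
  have hmK : ∀ j, AEStronglyMeasurable (uncurry fun t => kernel ε ⋆ w j t) μT := fun j =>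
    (hKst j).aestronglyMeasurable_uncurry_prod
  have hmP : ∀ j, AEStronglyMeasurable (uncurry (P j)) μT := fun j => (hmK j).sub (hmw j)
  have hmQ : AEStronglyMeasurable (uncurry Q) μT := (hmK n).sub (hmK m)
  have hmPP : AEStronglyMeasurable (uncurry fun t x => P m t x - P n t x) μT := (hmP m).sub (hmP n)
  have hslice : ∀ j, ∀ t ∈ Ioo 0 T, IsSmooth (w j t) := fun j t ht => (hw j).isSmooth_slice ht
  have hDslice : ∀ t ∈ Ioo 0 T, IsSmooth (D t) := fun t ht => hDst.isSmooth_slice ht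
  -- (i) decomposition and Minkowski
  have hdecomp : ∀ t x, w n t x - w m t x = (P m t x - P n t x) + Q t x := by
    intro t x
    simp only [hP, hQ]
    abel
  have hMink : (∫⁻ t in Ioo 0 T, ∫⁻ x, ‖w n t x - w m t x‖ₑ ^ 3) ^ (1 / 3 : ℝ) ≤
      (∫⁻ t in Ioo 0 T, ∫⁻ x, ‖P m t x‖ₑ ^ 3) ^ (1 / 3 : ℝ) +
        (∫⁻ t in Ioo 0 T, ∫⁻ x, ‖P n t x‖ₑ ^ 3) ^ (1 / 3 : ℝ) +
          (∫⁻ t in Ioo 0 T, ∫⁻ x, ‖Q t x‖ₑ ^ 3) ^ (1 / 3 : ℝ) := by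
    calc (∫⁻ t in Ioo 0 T, ∫⁻ x, ‖w n t x - w m t x‖ₑ ^ 3) ^ (1 / 3 : ℝ)
        = (∫⁻ t in Ioo 0 T, ∫⁻ x, ‖(P m t x - P n t x) + Q t x‖ₑ ^ 3) ^ (1 / 3 : ℝ) := by
          simp_rw [hdecomp]
      _ ≤ (∫⁻ t in Ioo 0 T, ∫⁻ x, ‖P m t x - P n t x‖ₑ ^ 3) ^ (1 / 3 : ℝ) +
            (∫⁻ t in Ioo 0 T, ∫⁻ x, ‖Q t x‖ₑ ^ 3) ^ (1 / 3 : ℝ) := rpow_lintegral_add_le hmPP hmQ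
      _ ≤ _ := by
          gcongr ?_ + _
          exact rpow_lintegral_sub_le (hmP m) (hmP n)
  -- (ii) the high-frequency parts: the ASSUMED mollification error
  have hhigh : ∀ j, (∫⁻ t in Ioo 0 T, ∫⁻ x, ‖P j t x‖ₑ ^ 3) ^ (1 / 3 : ℝ) ≤ ρ6 := by
    intro j
    calc (∫⁻ t in Ioo 0 T, ∫⁻ x, ‖P j t x‖ₑ ^ 3) ^ (1 / 3 : ℝ)
        ≤ (ρ6 ^ 3) ^ (1 / 3 : ℝ) := rpow_third_le_rpow_third (hmollε j)
      _ = ρ6 := pow_three_rpow_third _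
  -- (iii) the space–time `L³` norms of the fields and of the difference
  have hwL3 : ∀ j, (∫⁻ t in Ioo 0 T, ∫⁻ x, ‖w j t x‖ₑ ^ 3) ^ (1 / 3 : ℝ) ≤ B3 := fun j =>
    rpow_third_le_rpow_third (hwB j)
  have hDL3 : (∫⁻ t in Ioo 0 T, ∫⁻ y, ‖D t y‖ₑ ^ 3) ^ (1 / 3 : ℝ) ≤ 2 * B3 := by
    calc (∫⁻ t in Ioo 0 T, ∫⁻ y, ‖D t y‖ₑ ^ 3) ^ (1 / 3 : ℝ)
        ≤ (∫⁻ t in Ioo 0 T, ∫⁻ x, ‖w n t x‖ₑ ^ 3) ^ (1 / 3 : ℝ) +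
            (∫⁻ t in Ioo 0 T, ∫⁻ x, ‖w m t x‖ₑ ^ 3) ^ (1 / 3 : ℝ) := rpow_lintegral_sub_le (hmw n) (hmw m)
      _ ≤ B3 + B3 := add_le_add (hwL3 n) (hwL3 m)
      _ = 2 * B3 := (two_mul B3).symm
  -- (iv) the mollified difference: pointwise Fourier bound
  have hQeq : ∀ t ∈ Ioo 0 T, ∀ x, Q t x = (kernel ε ⋆ D t) x := by
    intro t ht x
    simp only [hQ, hD]
    exact (kernel_convolution_sub_right hε0 hε4 (hslice n t ht).continuous (hslice m t ht).continuous x).symm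
  have hQpt : ∀ t ∈ Ioo 0 T, ∀ x, ‖Q t x‖ₑ ^ 3 ≤ ‖S t + mm t * τ K‖ₑ ^ 3 := by
    intro t ht x
    have h1 : ‖Q t x‖ ≤ S t + mm t * τ K := by
      rw [hQeq t ht x]
      exact norm_kernel_convolution_apply_le (hDslice t ht) hε0 hε4 K x
    have h2 : ‖Q t x‖ₑ ≤ ‖S t + mm t * τ K‖ₑ := by
      rw [← ofReal_norm, ← ofReal_norm]
      exact ENNReal.ofReal_le_ofReal (h1.trans (le_abs_self _))
    gcongr
  -- continuity (hence measurability) in time of the bounding functions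
  have hScont : ContinuousOn S (Ioo 0 T) := by
    simp only [hS, hDhat]
    refine continuousOn_finsetSum _ fun k _ => ?_
    exact (continuousOn_mFourierCoeff_of_continuousOn_stLift hDst.continuousOn_stLift k).norm
  have hmmcont : ContinuousOn mm (Ioo 0 T) :=
    continuousOn_integral_of_continuousOn_stLift
      (continuous_norm.comp_continuousOn hDst.continuousOn_stLift)
  have hSm : AEStronglyMeasurable S (volume.restrict (Ioo 0 T)) :=
    hScont.aestronglyMeasurable measurableSet_Ioo
  have hmmm : AEStronglyMeasurable mm (volume.restrict (Ioo 0 T)) :=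
    hmmcont.aestronglyMeasurable measurableSet_Ioo
  have hmmτ : AEStronglyMeasurable (fun t => mm t * τ K) (volume.restrict (Ioo 0 T)) :=
    hmmm.mul_const _
  -- the `L³(0,T)` norm of `mm` is at most the space–time norm of `D`
  have hmmL3 : eLpNorm mm 3 (volume.restrict (Ioo 0 T)) ≤ 2 * B3 := by
    rw [eLpNorm_restrict_three_eq]
    refine (rpow_third_le_rpow_third (setLIntegral_mono' measurableSet_Ioo fun t ht => ?_)).trans hDL3
    calc ‖mm t‖ₑ ^ 3 ≤ eLpNorm (D t) 3 volume ^ 3 := by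
          gcongr
          exact enorm_integral_norm_le_eLpNorm_three (hDslice t ht).continuous
      _ = ∫⁻ y, ‖D t y‖ₑ ^ 3 := (lintegral_enorm_pow_three_eq _).symm
  -- the `L³(0,T)` norm of `S` is at most `c δ ≤ ρ/3`
  have hSL3 : eLpNorm S 3 (volume.restrict (Ioo 0 T)) ≤ ρ / 3 := by
    have hSeq : S = ∑ k ∈ freqBall (d := d) K, fun t => ‖Dhat t k‖ := by
      funext t
      simp only [hS, Finset.sum_apply]
    have hterm : ∀ k ∈ freqBall (d := d) K,
        eLpNorm (fun t => ‖Dhat t k‖) 3 (volume.restrict (Ioo 0 T)) ≤ δ := by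
      intro k hk
      rw [eLpNorm_norm, eLpNorm_restrict_three_eq]
      have hcongr : ∫⁻ t in Ioo 0 T, ‖Dhat t k‖ₑ ^ 3 =
          ∫⁻ t in Ioo 0 T, ‖mFourierCoeff (EuclideanSpace.complexify ∘ w n t) k -
            mFourierCoeff (EuclideanSpace.complexify ∘ w m t) k‖ₑ ^ 3 := by
        refine setLIntegral_congr_fun measurableSet_Ioo fun t ht => ?_
        simp only [hDhat, hD]
        have e1 : (EuclideanSpace.complexify ∘ fun y => w n t y - w m t y) =
            EuclideanSpace.complexify ∘ w n t - EuclideanSpace.complexify ∘ w m t := by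
          funext y
          simp [map_sub]
        rw [e1, mFourierCoeff_sub]
        · exact EuclideanSpace.complexify.toContinuousLinearMap.integrable_comp (hslice n t ht).integrable
        · exact EuclideanSpace.complexify.toContinuousLinearMap.integrable_comp (hslice m t ht).integrable
      rw [hcongr]
      calc (∫⁻ t in Ioo 0 T, ‖mFourierCoeff (EuclideanSpace.complexify ∘ w n t) k -
            mFourierCoeff (EuclideanSpace.complexify ∘ w m t) k‖ₑ ^ 3) ^ (1 / 3 : ℝ)
          ≤ (δ ^ 3) ^ (1 / 3 : ℝ) :=
            rpow_third_le_rpow_third (hNk k n m (hNk' k hk).1 (hNk' k hk).2)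
        _ = δ := pow_three_rpow_third δ
    calc eLpNorm S 3 (volume.restrict (Ioo 0 T))
        = eLpNorm (∑ k ∈ freqBall (d := d) K, fun t => ‖Dhat t k‖) 3 (volume.restrict (Ioo 0 T)) := by
          rw [hSeq]
      _ ≤ ∑ k ∈ freqBall (d := d) K, eLpNorm (fun t => ‖Dhat t k‖) 3 (volume.restrict (Ioo 0 T)) :=
          eLpNorm_sum_le (fun k _ =>
            ((continuousOn_mFourierCoeff_of_continuousOn_stLift hDst.continuousOn_stLift k).norm
              ).aestronglyMeasurable measurableSet_Ioo) (by norm_num)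
      _ ≤ ∑ _k ∈ freqBall (d := d) K, δ := Finset.sum_le_sum hterm
      _ = c * δ := by rw [Finset.sum_const, nsmul_eq_mul]
      _ ≤ ρ / 3 := ENNReal.mul_div_le
  -- the mollified difference in `L³_{t,x}`
  have hQL3 : (∫⁻ t in Ioo 0 T, ∫⁻ x, ‖Q t x‖ₑ ^ 3) ^ (1 / 3 : ℝ) ≤ ρ / 3 + ρ / 3 := by
    have h1 : ∫⁻ t in Ioo 0 T, ∫⁻ x, ‖Q t x‖ₑ ^ 3 ≤ ∫⁻ t in Ioo 0 T, ‖S t + mm t * τ K‖ₑ ^ 3 := by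
      calc ∫⁻ t in Ioo 0 T, ∫⁻ x, ‖Q t x‖ₑ ^ 3
          ≤ ∫⁻ t in Ioo 0 T, ∫⁻ _x : UnitAddTorus d, ‖S t + mm t * τ K‖ₑ ^ 3 :=
            setLIntegral_mono' measurableSet_Ioo fun t ht => lintegral_mono fun x => hQpt t ht x
        _ = ∫⁻ t in Ioo 0 T, ‖S t + mm t * τ K‖ₑ ^ 3 := lintegral_lintegral_const_right _
    have h2 : (∫⁻ t in Ioo 0 T, ‖S t + mm t * τ K‖ₑ ^ 3) ^ (1 / 3 : ℝ) =
        eLpNorm (fun t => S t + mm t * τ K) 3 (volume.restrict (Ioo 0 T)) :=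
      (eLpNorm_restrict_three_eq _).symm
    have h3 : eLpNorm (fun t => S t + mm t * τ K) 3 (volume.restrict (Ioo 0 T)) ≤
        eLpNorm S 3 (volume.restrict (Ioo 0 T)) +
          eLpNorm (fun t => mm t * τ K) 3 (volume.restrict (Ioo 0 T)) :=
      eLpNorm_add_le hSm hmmτ (by norm_num)
    have h4 : eLpNorm (fun t => mm t * τ K) 3 (volume.restrict (Ioo 0 T)) =
        ENNReal.ofReal (τ K) * eLpNorm mm 3 (volume.restrict (Ioo 0 T)) := by
      have e1 : (fun t => mm t * τ K) = (τ K) • mm := by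
        funext t
        simp [mul_comm]
      rw [e1, eLpNorm_const_smul, Real.enorm_of_nonneg (hτ0 K)]
    calc (∫⁻ t in Ioo 0 T, ∫⁻ x, ‖Q t x‖ₑ ^ 3) ^ (1 / 3 : ℝ)
        ≤ (∫⁻ t in Ioo 0 T, ‖S t + mm t * τ K‖ₑ ^ 3) ^ (1 / 3 : ℝ) := rpow_third_le_rpow_third h1
      _ ≤ eLpNorm S 3 (volume.restrict (Ioo 0 T)) +
            ENNReal.ofReal (τ K) * eLpNorm mm 3 (volume.restrict (Ioo 0 T)) := by rw [h2, ← h4]; exact h3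
      _ ≤ ρ / 3 + ENNReal.ofReal (τ K) * (2 * B3) := by gcongr
      _ ≤ ρ / 3 + ρ / 3 := by gcongr
  -- (v) conclusion
  have hfinal : (∫⁻ t in Ioo 0 T, ∫⁻ x, ‖w n t x - w m t x‖ₑ ^ 3) ^ (1 / 3 : ℝ) ≤ ρ := by
    calc (∫⁻ t in Ioo 0 T, ∫⁻ x, ‖w n t x - w m t x‖ₑ ^ 3) ^ (1 / 3 : ℝ)
        ≤ ρ6 + ρ6 + (ρ / 3 + ρ / 3) :=
          hMink.trans (add_le_add (add_le_add (hhigh m) (hhigh n)) hQL3)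
      _ = ρ / 3 + (ρ / 3 + ρ / 3) := by rw [hρ6, ENNReal.add_halves]
      _ = ρ := by rw [← add_assoc, ENNReal.add_thirds]
  have hcube : ∀ a : ℝ≥0∞, (a ^ (1 / 3 : ℝ)) ^ 3 = a := fun a => by
    rw [show (1 / 3 : ℝ) = ((3 : ℕ) : ℝ)⁻¹ by norm_num, ENNReal.rpow_inv_natCast_pow (by norm_num)]
  calc ∫⁻ t in Ioo 0 T, ∫⁻ x, ‖w n t x - w m t x‖ₑ ^ 3
      = ((∫⁻ t in Ioo 0 T, ∫⁻ x, ‖w n t x - w m t x‖ₑ ^ 3) ^ (1 / 3 : ℝ)) ^ 3 := (hcube _).symm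
    _ ≤ ρ ^ 3 := by gcongr
    _ = η := hcube η

/-- **Registered sub-stub `stub_krSpaceTimeCauchy`** (H5 of the STUB-PLAN for
`stub_kolmogorovRieszPeriodicSlab`, `d = Fin 3`): `L³((0,T) × 𝕋³)` Cauchy from a uniform
mollification error and Cauchy Fourier modes
(`exists_forall_lintegral_sub_pow_three_le_of_modes_of_mollify`; the convolution is spelled out as
`MeasureTheory.convolution (kernel ε) (w n t) (lsmul ℝ ℝ) volume x`, definitionally
`(kernel ε ⋆ w n t) x`). [cite: Simon1986, §8 Thm. 5] -/
theorem stub_krSpaceTimeCauchy :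
    ∀ (T : ℝ) (B : ENNReal) (w : ℕ → ℝ → UnitAddTorus (Fin 3) → EuclideanSpace ℝ (Fin 3)), 0 < T → B ≠ ⊤ → (∀ n, Literature.Analysis.FunctionSpaces.Torus.IsSmoothSpaceTimeOn (Set.Ioo 0 T) (w n)) → (∀ n, ∫⁻ t in Set.Ioo 0 T, ∫⁻ x, ‖w n t x‖ₑ ^ 3 ≤ B) → (∀ ρ : ENNReal, 0 < ρ → ∃ ε : ℝ, 0 < ε ∧ ε ≤ 1 / 4 ∧ ∀ n, ∫⁻ t in Set.Ioo 0 T, ∫⁻ x, ‖MeasureTheory.convolution (Literature.Analysis.FunctionSpaces.Torus.kernel ε) (w n t) (ContinuousLinearMap.lsmul ℝ ℝ) MeasureTheory.volume x - w n t x‖ₑ ^ 3 ≤ ρ) → (∀ k : Fin 3 → ℤ, ∀ η : ENNReal, 0 < η → ∃ N : ℕ, ∀ n m : ℕ, N ≤ n → N ≤ m → ∫⁻ t in Set.Ioo 0 T, ‖UnitAddTorus.mFourierCoeff (Literature.Analysis.FunctionSpaces.EuclideanSpace.complexify ∘ w n t) k - UnitAddTorus.mFourierCoeff (Literature.Analysis.FunctionSpaces.EuclideanSpace.complexify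 ∘ w m t) k‖ₑ ^ 3 ≤ η) → ∀ η : ENNReal, 0 < η → ∃ N : ℕ, ∀ n m : ℕ, N ≤ n → N ≤ m → ∫⁻ t in Set.Ioo 0 T, ∫⁻ x, ‖w n t x - w m t x‖ₑ ^ 3 ≤ η :=
  fun _T _B _w hT hB hw hwB hmoll hmode _η hη =>
    exists_forall_lintegral_sub_pow_three_le_of_modes_of_mollify hT hw hB hwB hmoll hmode hη

end Summit.AnomalousDissipation.AnomalousDissipation.Theorems.EulerLimitKR

end
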